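import Mathlib.Data.Nat.Choose.Central
import Literature.Computability.MetaComplexity.SmolenskyDimensionBound
import Literature.Computability.MetaComplexity.RazborovSmolenskyApprox
import HarnessLib

/-!
# Smolensky's theorem: usefulness of the natural property against `AC⁰[p]`, PARITY ∉ `AC⁰[p]`

Assembly of `SmolenskyProperty.lean` (the property `dim(f̄L + L) ≥ (3/4)2ⁿ` and its largeness),
`SmolenskyDimensionBound.lean` (the dimension bound from a low-degree approximation) and
`RazborovSmolensky{Poly,Approx}.lean` (the approximation lemma) into the two classical statements
(groundwork for the named fact `Literature.Computability.Learning.cikk_learn_AC0Mod`, CIKK 2016 Cor. 5.4, whose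
proof uses CIKK Thm. 5.3 = these facts):

* **Usefulness** (`not_mem_property_of_computes`, CIKK Thm. 5.3 / Smolensky 1987, Thm. 1): for a
  prime `p`, odd `n`, a circuit `C` over `accBasis p` of `acDepth ≤ d` and size `s` computing `h`,
  and any `ℓ ≥ 1` with `4 · ((p-1)ℓ)^d · C(n, n/2) · p^ℓ + 4 · s · 2ⁿ < 2ⁿ · p^ℓ`, the function `h`
  does NOT have Smolensky's property over `𝔽_p`. (Reading: with `ℓ ≈ n^{1/(2d)}/(p-1)` the first
  term is `≤ 2ⁿp^ℓ/2`, so every `h` with the property needs `s ≥ p^ℓ/8 = 2^{Ω(n^{1/(2d)})}`.)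
* **PARITY has the property** (`parityFn_mem_property`, for odd `n` and `2 ≠ 0` in `F`:
  `f̄ = ḡ` and `ḡL + L` is everything), and hence **Smolensky's lower bound**
  (`smolensky_parity`, Smolensky 1987, Thm. 2 / Cor. for `q = 2`): for an odd prime `p`, odd `n`,
  and a circuit over `{¬, ∧, ∨, MOD_p}` of `acDepth ≤ d` computing PARITY of `n` bits, every
  `ℓ ≥ 1` with `64 · ((p-1)ℓ)^{2d} ≤ n` satisfies `p^ℓ ≤ 8 · size` — i.e. size
  `≥ p^{⌊n^{1/(2d)} / (8^{1/d}(p-1))⌋}/8 = 2^{Ω(n^{1/(2d)})}`.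

Also: the elementary central binomial estimate `C(n, n/2)² · n ≤ 4ⁿ` for odd `n`
(`choose_half_sq_mul_le`), from `(2m+1) · C(2m,m)² ≤ 16^m`.

## References

* R. Smolensky, *Algebraic methods in the theory of lower bounds for Boolean circuit
  complexity*, STOC 1987, Thms. 1–2 and Corollary (p. 80) [Smolensky1987].
* M. Carmosino, R. Impagliazzo, V. Kabanets, A. Kolokolova, *Learning algorithms from natural
  proofs*, CCC 2016, Thm. 5.3 [CarmosinoImpagliazzoKabanetsKolokolova2016].
* A. Razborov, S. Rudich, *Natural proofs*, JCSS 55 (1997), §3 [RazborovRudich1997].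
-/

noncomputable section

namespace Literature.Computability.MetaComplexity

open Finset Literature.Computability.Complexity

namespace Smolensky

/-! ### The central binomial coefficient: `C(n, n/2)² · n ≤ 4ⁿ` for odd `n` -/

/-- `(2m+1) · C(2m, m)² ≤ 16^m` (induction on `m` with
`(m+1) C(2m+2, m+1) = 2(2m+1) C(2m, m)`). [folklore] -/
theorem succ_mul_centralBinom_sq_le (m : ℕ) :
    (2 * m + 1) * Nat.centralBinom m ^ 2 ≤ 16 ^ m := by
  induction m with
  | zero => simp [Nat.centralBinom_zero]
  | succ m ih =>
    have hrec := Nat.succ_mul_centralBinom_succ m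
    -- `(m+1)² (2m+3) C_{m+1}² = 4 (2m+1)² (2m+3) C_m² ≤ 4 (2m+1)(2m+3) 16^m ≤ 16 (m+1)² 16^m`
    have key : (m + 1) ^ 2 * ((2 * (m + 1) + 1) * Nat.centralBinom (m + 1) ^ 2) ≤
        (m + 1) ^ 2 * 16 ^ (m + 1) := by
      calc (m + 1) ^ 2 * ((2 * (m + 1) + 1) * Nat.centralBinom (m + 1) ^ 2)
          = (2 * m + 3) * ((m + 1) * Nat.centralBinom (m + 1)) ^ 2 := by ring
        _ = (2 * m + 3) * (2 * (2 * m + 1) * Nat.centralBinom m) ^ 2 := by rw [hrec]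
        _ = 4 * (2 * m + 1) * (2 * m + 3) * ((2 * m + 1) * Nat.centralBinom m ^ 2) := by ring
        _ ≤ 4 * (2 * m + 1) * (2 * m + 3) * 16 ^ m := Nat.mul_le_mul_left _ ih
        _ ≤ (m + 1) ^ 2 * 16 ^ (m + 1) := by
            have h16 : 4 * (2 * m + 1) * (2 * m + 3) ≤ 16 * (m + 1) ^ 2 := by
              have e : 4 * (2 * m + 1) * (2 * m + 3) + 4 = 16 * (m + 1) ^ 2 := by ring
              omega
            calc 4 * (2 * m + 1) * (2 * m + 3) * 16 ^ m ≤ 16 * (m + 1) ^ 2 * 16 ^ m :=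
                  Nat.mul_le_mul_right _ h16
              _ = (m + 1) ^ 2 * 16 ^ (m + 1) := by ring
    exact Nat.le_of_mul_le_mul_left key (by positivity)

/-- For odd `n = 2m+1`: `C(n, m) ≤ 2 · C(2m, m)`. [folklore] -/
theorem choose_half_le_two_mul_centralBinom (m : ℕ) :
    (2 * m + 1).choose m ≤ 2 * Nat.centralBinom m := by
  have h := Nat.add_one_mul_choose_eq (2 * m) m
  rw [Nat.choose_symm_half] at h
  -- h : (2m+1) * C(2m, m) = C(2m+1, m) * (m+1)
  have h2 : (2 * m + 1).choose m * (m + 1) ≤ 2 * Nat.centralBinom m * (m + 1) := by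
    rw [← h, Nat.centralBinom_eq_two_mul_choose]
    nlinarith [Nat.zero_le ((2 * m).choose m)]
  exact Nat.le_of_mul_le_mul_right h2 (Nat.succ_pos m)

/-- **The middle binomial coefficient of an odd `n` is at most `2ⁿ/√n`**, in the form
`C(n, n/2)² · n ≤ 4ⁿ`. [folklore] -/
theorem choose_half_sq_mul_le {n : ℕ} (hn : Odd n) : n.choose (n / 2) ^ 2 * n ≤ 4 ^ n := by
  obtain ⟨m, rfl⟩ := hn
  have hm : (2 * m + 1) / 2 = m := by omega
  rw [hm]
  have h1 := choose_half_le_two_mul_centralBinom m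
  have h2 := succ_mul_centralBinom_sq_le m
  calc (2 * m + 1).choose m ^ 2 * (2 * m + 1)
      ≤ (2 * Nat.centralBinom m) ^ 2 * (2 * m + 1) :=
        Nat.mul_le_mul_right _ (Nat.pow_le_pow_left h1 2)
    _ = 4 * ((2 * m + 1) * Nat.centralBinom m ^ 2) := by ring
    _ ≤ 4 * 16 ^ m := Nat.mul_le_mul_left _ h2
    _ = 4 ^ (2 * m + 1) := by
        rw [pow_succ, pow_mul]
        norm_num [mul_comm]

/-! ### Usefulness of Smolensky's property against `AC⁰[p]` -/

variable {n : ℕ} {p : ℕ} [Fact p.Prime]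

/-- **Usefulness of Smolensky's property against `AC⁰[p]`** (CIKK Thm. 5.3; Smolensky 1987,
Thm. 1), exact form: for a prime `p`, odd `n`, a circuit `C` over `accBasis p` of `acDepth ≤ d`
computing `h`, and `ℓ ≥ 1` with `4 · ((p-1)ℓ)^d · C(n,n/2) · p^ℓ + 4 · size(C) · 2ⁿ < 2ⁿ · p^ℓ`,
the function `h` does not have the property `dim(f̄L + L) ≥ (3/4)2ⁿ` over `𝔽_p`. (Approximate `C`
by a polynomial of degree `D = ((p-1)ℓ)^d` off a set `E` with `|E| p^ℓ ≤ size · 2ⁿ`, then apply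
the dimension bound.) [cite: CarmosinoImpagliazzoKabanetsKolokolova2016, Thm. 5.3] -/
theorem not_mem_property_of_computes (hn : Odd n) {d : ℕ} (C : Circuit (Fin n))
    (hC : C.IsOver (accBasis p)) (hd : C.acDepth ≤ d) {h : (Fin n → Bool) → Bool}
    (hh : C.Computes h) {ℓ : ℕ} (hℓ : 1 ≤ ℓ)
    (hlt : 4 * ((p - 1) * ℓ) ^ d * n.choose (n / 2) * p ^ ℓ + 4 * C.size * 2 ^ n < 2 ^ n * p ^ ℓ) :
    h ∉ property (ZMod p) n := by
  have hp := (Fact.out : p.Prime)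
  have hM1 : 1 ≤ (p - 1) * ℓ := Nat.mul_pos (by have := hp.two_le; omega) hℓ
  obtain ⟨P, E, hP, hE, hPE⟩ := razborov_smolensky C hC hℓ
  have hP' : P ∈ lowDeg (ZMod p) n (((p - 1) * ℓ) ^ d) :=
    lowDeg_mono (Nat.pow_le_pow_right hM1 hd) hP
  refine not_mem_property hn h (D := ((p - 1) * ℓ) ^ d) (P := 1 - (2 : ZMod p) • P) ?_ E ?_ ?_
  · exact Submodule.sub_mem _ (one_mem_lowDeg _) (Submodule.smul_mem _ _ hP')
  · intro b hb
    rw [Pi.sub_apply, Pi.one_apply, Pi.smul_apply, smul_eq_mul, hPE b hb, hh b]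
    simp only [pmOf, bit]
    split <;> norm_num
  · -- `4 (D C(n,n/2) + |E|) p^ℓ ≤ 4 D C p^ℓ + 4 s 2ⁿ < 2ⁿ p^ℓ`
    have hppos : 0 < p ^ ℓ := pow_pos hp.pos ℓ
    refine Nat.lt_of_mul_lt_mul_right (a := p ^ ℓ) ?_
    calc 4 * (((p - 1) * ℓ) ^ d * n.choose (n / 2) + E.card) * p ^ ℓ
        = 4 * ((p - 1) * ℓ) ^ d * n.choose (n / 2) * p ^ ℓ + 4 * (E.card * p ^ ℓ) := by ring
      _ ≤ 4 * ((p - 1) * ℓ) ^ d * n.choose (n / 2) * p ^ ℓ + 4 * (C.size * 2 ^ n) :=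
          Nat.add_le_add_left (Nat.mul_le_mul_left 4 hE) _
      _ = 4 * ((p - 1) * ℓ) ^ d * n.choose (n / 2) * p ^ ℓ + 4 * C.size * 2 ^ n := by ring
      _ < 2 ^ n * p ^ ℓ := hlt

/-! ### PARITY has the property; Smolensky's lower bound -/

/-- The `±1` version of PARITY is the character `ḡ = Π (1 - 2xᵢ)`. [folklore] -/
theorem pmOf_parityFn {F : Type*} [Field F] (n : ℕ) : pmOf F (parityFn n) = pmMono F univ := by
  funext b
  rw [pmMono_univ_apply]
  simp only [pmOf, parityFn, GateFn.numOnes, Nat.odd_iff, decide_eq_true_eq]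

/-- **PARITY has Smolensky's property** over any field with `2 ≠ 0`, for odd `n`: indeed
`f̄ = ḡ` and `ḡL + L = ⊤`, so `dim(f̄L + L) = 2ⁿ`. [cite: Smolensky1987, p. 80 (MOD_q is U_F-complete)] -/
theorem parityFn_mem_property {F : Type*} [Field F] (hn : Odd n) (h2 : (2 : F) ≠ 0) :
    parityFn n ∈ property F n := by
  rw [mem_property_iff]
  have htop : space F (parityFn n) = ⊤ := by
    rw [space, pmOf_parityFn]
    exact map_mulLeft_parity_sup_eq_top hn h2
  rw [htop, finrank_top, finrank_cubeFn]
  omega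

/-- **Smolensky's theorem (PARITY ∉ AC⁰[p], quantitative).** Let `p` be an odd prime, `n` odd,
and `C` a circuit over `accBasis p = {¬, ∧ₖ, ∨ₖ, MOD_{p,k}}` of `acDepth ≤ d` computing the parity
of `n` bits. Then for every `ℓ ≥ 1` with `64 · ((p-1)ℓ)^{2d} ≤ n` one has `p^ℓ ≤ 8 · size(C)`;
in particular (taking the largest such `ℓ`) the size is `2^{Ω(n^{1/(2d)})}` (Smolensky 1987,
Thm. 2 with Lemma 5 for `q = 2`: "any depth `k` circuit … computing MOD_q requires
`exp(Ω(n^{1/(2k)}))` gates"). [cite: Smolensky1987, Thm. 2 and Corollary] -/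
theorem smolensky_parity (hp2 : p ≠ 2) (hn : Odd n) {d : ℕ} (C : Circuit (Fin n))
    (hC : C.IsOver (accBasis p)) (hd : C.acDepth ≤ d) (hpar : C.Computes (parityFn n)) {ℓ : ℕ}
    (hℓ : 1 ≤ ℓ) (hℓn : 64 * ((p - 1) * ℓ) ^ (2 * d) ≤ n) : p ^ ℓ ≤ 8 * C.size := by
  have hp := (Fact.out : p.Prime)
  have h2F : (2 : ZMod p) ≠ 0 := by
    intro h
    have h' : ((2 : ℕ) : ZMod p) = 0 := by exact_mod_cast h
    rw [ZMod.natCast_eq_zero_iff] at h'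
    exact hp2 ((Nat.prime_dvd_prime_iff_eq hp Nat.prime_two).1 h')
  have hmem := parityFn_mem_property (F := ZMod p) hn h2F
  -- the usefulness inequality must therefore FAIL
  have hfail : 2 ^ n * p ^ ℓ ≤
      4 * ((p - 1) * ℓ) ^ d * n.choose (n / 2) * p ^ ℓ + 4 * C.size * 2 ^ n := by
    by_contra hlt
    exact not_mem_property_of_computes hn C hC hd hpar hℓ (not_le.1 hlt) hmem
  -- `8 D C(n,n/2) ≤ 2ⁿ` from `64 D² ≤ n` and `C(n,n/2)² n ≤ 4ⁿ`
  have hDC : 8 * (((p - 1) * ℓ) ^ d * n.choose (n / 2)) ≤ 2 ^ n := by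
    have hsq : (8 * (((p - 1) * ℓ) ^ d * n.choose (n / 2))) ^ 2 ≤ (2 ^ n) ^ 2 := by
      calc (8 * (((p - 1) * ℓ) ^ d * n.choose (n / 2))) ^ 2
          = 64 * ((p - 1) * ℓ) ^ (2 * d) * n.choose (n / 2) ^ 2 := by ring
        _ ≤ n * n.choose (n / 2) ^ 2 := Nat.mul_le_mul_right _ hℓn
        _ = n.choose (n / 2) ^ 2 * n := by ring
        _ ≤ 4 ^ n := choose_half_sq_mul_le hn
        _ = (2 ^ n) ^ 2 := by rw [← pow_mul, mul_comm, pow_mul]; norm_num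
    exact (Nat.pow_le_pow_iff_left two_ne_zero).1 hsq
  -- conclude: `2 · 2ⁿ p^ℓ ≤ 8 D C(n,n/2) p^ℓ + 8 s 2ⁿ ≤ 2ⁿ p^ℓ + 8 s 2ⁿ`
  have h1 : 8 * (((p - 1) * ℓ) ^ d * n.choose (n / 2)) * p ^ ℓ ≤ 2 ^ n * p ^ ℓ :=
    Nat.mul_le_mul_right _ hDC
  have h2 : 2 * (2 ^ n * p ^ ℓ) ≤ 2 ^ n * p ^ ℓ + 2 ^ n * (8 * C.size) := by
    calc 2 * (2 ^ n * p ^ ℓ)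
        ≤ 2 * (4 * ((p - 1) * ℓ) ^ d * n.choose (n / 2) * p ^ ℓ + 4 * C.size * 2 ^ n) :=
          Nat.mul_le_mul_left 2 hfail
      _ = 8 * (((p - 1) * ℓ) ^ d * n.choose (n / 2)) * p ^ ℓ + 2 ^ n * (8 * C.size) := by ring
      _ ≤ 2 ^ n * p ^ ℓ + 2 ^ n * (8 * C.size) := Nat.add_le_add_right h1 _
  have hfin : 2 ^ n * p ^ ℓ ≤ 2 ^ n * (8 * C.size) := by omega
  exact Nat.le_of_mul_le_mul_left hfin (pow_pos two_pos n)

end Smolensky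

end Literature.Computability.MetaComplexity
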